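import Summits.BirchSwinnertonDyer.BirchSwinnertonDyer.Theses.KatoDescentTamePotSupersingular
import Summits.BirchSwinnertonDyer.BirchSwinnertonDyer.Theorems.KatoDescentPotSupersingularReducibleUpperOfCountInputsNodes
import HarnessLib

/-!
# Route `KatoDescentTamePotSupersingular` (rung K8-t′, cell `bsd-potss`): the crux `TameUpperReducibleDefect`
# (item stmt-BirchSwinnertonDyer-19203, U₀-red (t′)) FROM ONE CITE-LEVEL INPUT — Kato's SHARP member count —
# thin route-typed restatement of `Theorems.ReducibleUpperOfCountInputs.tameUpperReducibleDefect_body`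

The crux U₀-red of the route (`E[p]` reducible, `r_an = 0`, (t′) at `p ≠ 2`, a `ℤ/p²`-member in the class or odd
`ord_p #Ш_an`: the UPPER half `ord_p #Ш ≤ ord_p #Ш_an`) follows — with its defect hypothesis UNUSED, i.e. on
EVERY reducible (t′) row — from the three named Literature facts `Kato2004.nonempty_iwasawaH1Data`,
`ModularForms.exists_isNewformOf`, `Kato2004.exists_memberHullCountInputs` (seat kmc Part 16:
`Kato2004/MemberHullCountInputs.lean`, the SHARP rank-`0` count inputs at Kato's member on top of
`MemberHullInputs` — Kato (14.9.3) counted as in the proof of Prop. 14.16 with `#H¹_f(ℤ[1/p],T)` kept as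
the torsion part + the Poitou–Tate count of `Sel(T) ⊂ S(T)`) and the named facts Cassels
(`bsdRHS_eq_of_isIsogenous`), GZK (`rank_eq_analyticRank_of_analyticRank_le_one`), modularity
(`hasEntireLFunction_rat`) — all three already cite-level inputs of the route (`PublishedInputsTame` /
`KatoTamagawaExactInputs` families).  Mechanism (route-free node file
`KatoDescentPotSupersingularReducibleUpperOfCountInputsNodes.lean`): the kernel exact count gives
`ord_p #Ш(W_K) ≤ ord_p #Ш_an(W_K)` at Kato's member with NO torsion slack; Cassels transports it to `W`.
This file restates it with the route decl as its type, curried and in conjunction form (the closer a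
planner's glued split «published inputs → U₀-red» would use, M precedent 19660).  CONDITIONAL (audit
`proof.conditional`); the item is NOT closed by this file.  HONEST FRAMING: BSD is not advanced; U₀-red's
content is unchanged (Kato's Euler-system bound at an additive prime with `E[p]` reducible, read EXACTLY
at the member) and now rests on ONE named transcription (review flag
`Kato-14.9.3-count-Af-symbolic-member-reducible`) instead of three free hypothesis schemata (p420005).
Seat `bsd-potss-kmc` generation 9.

References: [Kato2004Asterisque] §14.8 (p. 238), (14.9.3) (p. 240), proof of Prop. 14.16 (pp. 244–245),
§14.14 (p. 243), Thm. 12.6 (p. 222); [GreenbergLNM1716] §3, appendix to §4; [CoatesLNM1716] Lemma 3.8;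
[Wuthrich2014] Lemma 14; [Cassels1965ArithmeticVIII].
-/

set_option autoImplicit false
-- sibling precedent (`KatoDescentTamePotSupersingularAssembly.lean`): the directory name repeats the summit name
set_option linter.dupNamespace false

noncomputable section

namespace Summit.BirchSwinnertonDyer.BirchSwinnertonDyer.Theorems

open WeierstrassCurve Literature.NumberTheory.EllipticCurves
  Literature.NumberTheory.EllipticCurves.ModularForms
  Literature.NumberTheory.EllipticCurves.Kato2004
  Literature.NumberTheory.EllipticCurves.Rank1Residual
  Literature.NumberTheory.EllipticCurves.Rank1Residual.Typed
  Summit.BirchSwinnertonDyer.Rank1Residual.Additive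
  Summit.BirchSwinnertonDyer.Rank1Residual

/-- **The K8-t′ crux `TameUpperReducibleDefect` (item stmt-BirchSwinnertonDyer-19203; type = the route decl
verbatim) from ONE cite-level input**: `nonempty_iwasawaH1Data → exists_isNewformOf →
exists_memberHullCountInputs → bsdRHS_eq_of_isIsogenous → rank_eq_analyticRank_of_analyticRank_le_one →
hasEntireLFunction_rat → TameUpperReducibleDefect` (the item's `ℤ/p²`-member / odd-parity hypothesis is
not used).  Conditional on the six named facts; the item is not closed by this theorem.
[cite: Kato2004Asterisque, proof of Prop. 14.16 (pp. 244–245), §14.14 (p. 243), Thm. 12.6 (p. 222)]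
[cite: GreenbergLNM1716, §3 and appendix to §4] [cite: Cassels1965ArithmeticVIII] -/
theorem tameUpperReducibleDefect_of_memberCountInputs (hne : Kato2004.nonempty_iwasawaH1Data)
    (hmod : exists_isNewformOf) (hin : Kato2004.exists_memberHullCountInputs)
    (hCassels : bsdRHS_eq_of_isIsogenous) (hGZK : rank_eq_analyticRank_of_analyticRank_le_one)
    (hmodL : hasEntireLFunction_rat) :
    Summit.BirchSwinnertonDyer.BirchSwinnertonDyer.Theses.KatoDescentTamePotSupersingular.TameUpperReducibleDefect :=
  ReducibleUpperOfCountInputs.tameUpperReducibleDefect_body hne hmod hin hCassels hGZK hmodL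

/-- **Conjunction form**: `(nonempty_iwasawaH1Data ∧ exists_isNewformOf ∧ exists_memberHullCountInputs) →
(bsdRHS_eq_of_isIsogenous ∧ rank_eq_analyticRank_of_analyticRank_le_one ∧ hasEntireLFunction_rat) →
TameUpperReducibleDefect`.  Conditional; nothing else assumed.
[cite: Kato2004Asterisque, proof of Prop. 14.16 (pp. 244–245)] [cite: Cassels1965ArithmeticVIII] -/
theorem tameUpperReducibleDefect_of_inputs_and
    (h : Kato2004.nonempty_iwasawaH1Data ∧ exists_isNewformOf ∧ Kato2004.exists_memberHullCountInputs)
    (h' : bsdRHS_eq_of_isIsogenous ∧ rank_eq_analyticRank_of_analyticRank_le_one ∧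
      hasEntireLFunction_rat) :
    Summit.BirchSwinnertonDyer.BirchSwinnertonDyer.Theses.KatoDescentTamePotSupersingular.TameUpperReducibleDefect :=
  tameUpperReducibleDefect_of_memberCountInputs h.1 h.2.1 h.2.2 h'.1 h'.2.1 h'.2.2

end Summit.BirchSwinnertonDyer.BirchSwinnertonDyer.Theorems

end
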